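import Literature.AlgebraicGeometry.Resolution.HenselizationGeneratorApproximation
import HarnessLib

/-!
# The Newton step for a polynomial with dominant linear Taylor term (Kuhlmann–Vlahu 2014, Lemma 10.4 with `𝐡 = 1`)

Topic: `Literature/AlgebraicGeometry/Resolution` (valued function fields). F.-V. Kuhlmann,
I. Vlahu, *The relative approximation degree in valued function fields*, Math. Z. 276 (2014) =
arXiv:1304.0200, **Lemma 10.4** ("there exists an element `z` in the algebraic closure of
`K(y)` such that `[K(y,z)^h : K(y)^h] ≤ 𝐡` and `v(x − z) ≥ (1/𝐡)(v(y − f(x)) − β_K(x:f))`";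
proof: "`F°(Z) := F(Z) − (d^𝐡/f_𝐡(c)) · r` … admits a factorization `F° = G°H°` over `K(y)^h`
with `G°v = Z^𝐡 − (x₀v)^𝐡`") in relative approximation degree `𝐡 = 1`, where `G°` is LINEAR and
`z ∈ K(y)^h` itself: the tree proves this (`exists_mem_valuation_sub_le_of_taylor`,
`HenselizationGeneratorApproximation.lean`) for the special polynomials `f ≈ X` occurring in
Thm. 11.1; here the same Hensel argument is run for an ARBITRARY polynomial `f` over `K` whose
linear Taylor term at the chosen centre dominates — the case `𝐡_K(x:f) = 1` of the relative
approximation degree (`ApproximationDegree.lean`), as needed for Prop. 10.5 / Cor. 10.8 and the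
pull down principle of §14 (the algebraic counterpart of the descent step of Temkin 2013,
Thm. 3.2.3).

## Content (PROVED; no definitions, no named facts)

* `exists_mem_valuation_sub_mul_eq_of_dominant` — **Lemma 10.4 with `𝐡 = 1`**: for `K ≤ L`
  henselian, `c ∈ K`, `b ∈ K^×` with `|b| = |x − c|`, `f` over `K` with Taylor terms
  `tᵢ = f^{[i]}(c) bⁱ`, `t₁ ≠ 0`, `|tᵢ| < |t₁|` (`i ≥ 2`), and `y ∈ L` with `|f(x) − y| < |t₁|`, some
  `ℓ ∈ L` has `|x − ℓ| · |t₁| = |b| · |f(x) − y|` [cite: KuhlmannVlahu2014, Lemma 10.4].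

## Sources

* F.-V. Kuhlmann, I. Vlahu, Math. Z. 276 (2014) = arXiv:1304.0200: §9 (proof of Thm. 9.1),
  Lemma 10.4 and Prop. 10.5 (pp. 20–21). [KuhlmannVlahu2014]

## Rendering notes

As in `HenselizationGeneratorApproximation.lean` (ambient `(Ω, V)`, `K L : Subfield Ω`,
`IsHenselianField`, Taylor coefficients via Mathlib's `taylor`, multiplicative values).
-/

noncomputable section

open IsLocalRing Polynomial Finset

namespace Literature.AlgebraicGeometry.Resolution

universe u

variable {Ω : Type u} [Field Ω] (V : ValuationSubring Ω)

/-- **Kuhlmann–Vlahu 2014, Lemma 10.4 in relative approximation degree `1`, for an arbitrary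
polynomial with dominant linear Taylor term** — `exists_mem_valuation_sub_le_of_taylor`
(`HenselizationGeneratorApproximation.lean`, where `f ≈ X` near `x`) generalized: `K ≤ L ≤ Ω`
with `(L, V ∩ L)` henselian, a centre `c ∈ K` and scale `b ∈ K^×` with `|b| = |x − c|`, a
polynomial `f` over `K` whose Taylor terms `tᵢ = f^{[i]}(c) bⁱ` at `c` satisfy `t₁ ≠ 0` and
`|tᵢ| < |t₁|` for `2 ≤ i ≤ deg f` (the linear term dominates: `𝐡_K(x:f) = 1` at this centre),
and `y ∈ L` with `|f(x) − y| < |t₁|`. Then some `ℓ ∈ L` has `|x − ℓ| · |t₁| = |b| · |f(x) − y|`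
("`v(x − z) ≥ (1/𝐡)(v(y − f(x)) − β_K(x:f))`" with `𝐡 = 1`, `β = v f₁(c) = v t₁ − v b`): the
polynomial `F°(Z) = (∑ tᵢ Zⁱ − y)/t₁` over `O_L` has reduction `unit + Z`, and Hensel's Lemma
in `L` gives a root `ζ` with `|x̃ − ζ| = |F°(x̃)|`, `x̃ = (x − c)/b`, `ℓ = c + bζ`. Same proof as
the tree lemma from its Step 3 on. [cite: KuhlmannVlahu2014, Lemma 10.4] -/
theorem exists_mem_valuation_sub_mul_eq_of_dominant (K : Subfield Ω) {x : Ω}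
    {L : Subfield Ω} (hL : IsHenselianField L (V.comap (algebraMap L Ω))) (hKL : K ≤ L)
    {c b : Ω} (hcK : c ∈ K) (hbK : b ∈ K) (hb0 : b ≠ 0) (hvb : V.valuation b = V.valuation (x - c))
    {f : Polynomial Ω} (hf : ∀ k, f.coeff k ∈ K)
    (he0' : (taylor c f).coeff 1 * b ^ 1 ≠ 0)
    (hdom : ∀ i, 2 ≤ i → i ≤ f.natDegree →
      V.valuation ((taylor c f).coeff i * b ^ i) < V.valuation ((taylor c f).coeff 1 * b ^ 1))
    {y : Ω} (hyL : y ∈ L)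
    (hfy : V.valuation (f.eval x - y) < V.valuation ((taylor c f).coeff 1 * b ^ 1)) :
    ∃ ℓ ∈ L, V.valuation (x - ℓ) * V.valuation ((taylor c f).coeff 1 * b ^ 1) =
      V.valuation b * V.valuation (f.eval x - y) := by
  classical
  /- Step 0: `f` is not constant. -/
  have hN : 0 < f.natDegree := by
    by_contra h0
    have h0' : f.natDegree = 0 := Nat.eq_zero_of_not_pos h0
    apply he0'
    have : (taylor c f).coeff 1 = 0 := by
      apply coeff_eq_zero_of_natDegree_lt
      rw [natDegree_taylor, h0']
      exact Nat.one_pos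
    rw [this, zero_mul]
  set N := f.natDegree with hNdef
  have hvb0 : V.valuation b ≠ 0 := (_root_.map_ne_zero _).mpr hb0
  have hvbpos : 0 < V.valuation b := zero_lt_iff.mpr hvb0
  -- `x̃ = (x - c)/b`, a unit
  obtain ⟨xt, hxt⟩ : ∃ xt : Ω, xt = (x - c) / b := ⟨_, rfl⟩
  have hxc : x - c = b * xt := by rw [hxt, mul_div_cancel₀ _ hb0]
  have hvxt : V.valuation xt = 1 := by rw [hxt, map_div₀, ← hvb, div_self hvb0]
  have hxtV : xt ∈ V := (V.valuation_le_one_iff _).mp hvxt.le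
  /- Step 3: the Taylor coefficients of `f`: `f₁(c)` is a `1`-unit, higher terms are small. -/
  obtain ⟨t, ht⟩ : ∃ t : ℕ → Ω, t = fun i => (taylor c f).coeff i * b ^ i := ⟨_, rfl⟩
  have hti' : ∀ i, t i = (taylor c f).coeff i * b ^ i := fun i => by rw [ht]
  have htK : ∀ i, t i ∈ K := fun i => by
    rw [hti']; exact mul_mem (coeff_taylor_mem K hf hcK i) (pow_mem hbK i)
  have ht0 : t 0 = f.eval c := by rw [hti', taylor_coeff_zero, pow_zero, mul_one]
  -- `e = t 1 = f₁(c) b` has value `v(b)`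
  obtain ⟨e, he⟩ : ∃ e : Ω, e = t 1 := ⟨_, rfl⟩
  have he0 : e ≠ 0 := by rw [he, hti']; exact he0'
  have hve0 : V.valuation e ≠ 0 := (_root_.map_ne_zero _).mpr he0
  have hti : ∀ i, 2 ≤ i → i ≤ N → V.valuation (t i) < V.valuation e := fun i hi hiN => by
    rw [he, hti', hti']; exact hdom i hi hiN
  /- Step 4: the coefficients `a i` of `F°` and the value `F°(x̃)`. -/
  obtain ⟨a, ha⟩ : ∃ a : ℕ → Ω, a = fun i => if i = 0 then (f.eval c - y) / e else t i / e :=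
    ⟨_, rfl⟩
  have ha0 : a 0 = (f.eval c - y) / e := by rw [ha]; simp
  have hai : ∀ i, 1 ≤ i → a i = t i / e := fun i hi => by rw [ha]; simp [show i ≠ 0 by omega]
  have ha1 : a 1 = 1 := by rw [hai 1 le_rfl, ← he]; exact div_self he0
  have hasmall : ∀ i, 2 ≤ i → i ≤ N → V.valuation (a i) < 1 := fun i hi hiN => by
    rw [hai i (by omega), map_div₀, div_lt_one₀ (zero_lt_iff.mpr hve0)]
    exact hti i hi hiN
  have heL : e ∈ L := by rw [he]; exact hKL (htK 1)
  have haL : ∀ i, a i ∈ L := fun i => by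
    rcases Nat.eq_zero_or_pos i with rfl | hi
    · rw [ha0]
      refine div_mem (sub_mem (hKL ?_) hyL) heL
      rw [← ht0]; exact htK 0
    · rw [hai i hi]; exact div_mem (hKL (htK i)) heL
  -- Taylor expansion of `f`
  have hexp_f : f.eval x = ∑ i ∈ range (N + 1), t i * xt ^ i := by
    have h1 : f.eval x = (taylor c f).eval (x - c) := by rw [taylor_eval, sub_add_cancel]
    rw [h1, eval_eq_sum_range' (by rw [natDegree_taylor]; exact Nat.lt_succ_self _)]
    refine sum_congr rfl fun i _ => ?_
    rw [hti', hxc, mul_pow, ← mul_assoc]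
  have hsplit : ∀ s : ℕ → Ω, ∑ i ∈ range (N + 1), s i = s 0 + ∑ i ∈ Ico 1 (N + 1), s i :=
    fun s => by rw [range_eq_Ico, sum_eq_sum_Ico_succ_bot (Nat.succ_pos N)]
  -- `∑ a i x̃^i = (f(x) - y)/e`
  have hsumx : ∑ i ∈ range (N + 1), a i * xt ^ i = (f.eval x - y) / e := by
    rw [hsplit, hexp_f, hsplit (fun i => t i * xt ^ i), ht0, ha0, pow_zero, mul_one]
    have htail : ∑ i ∈ Ico 1 (N + 1), a i * xt ^ i =
        (∑ i ∈ Ico 1 (N + 1), t i * xt ^ i) / e := by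
      rw [div_eq_mul_inv, Finset.sum_mul]
      refine sum_congr rfl fun i hi => ?_
      rw [mem_Ico] at hi
      rw [hai i hi.1]
      ring
    rw [htail]
    field_simp
    ring
  /- Step 5: `a 0` is a unit. -/
  have hvfxc : V.valuation (f.eval x - f.eval c) = V.valuation e := by
    have hfxc : f.eval x - f.eval c = ∑ i ∈ Ico 1 (N + 1), t i * xt ^ i := by
      rw [hexp_f, hsplit (fun i => t i * xt ^ i), ht0, pow_zero, mul_one]
      ring
    rw [hfxc, sum_eq_sum_Ico_succ_bot (by omega : 1 < N + 1), pow_one, ← he]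
    have htail : V.valuation (∑ i ∈ Ico 2 (N + 1), t i * xt ^ i) < V.valuation (e * xt) := by
      rw [map_mul, hvxt, mul_one]
      refine Valuation.map_sum_lt _ hve0 fun i hi => ?_
      rw [mem_Ico] at hi
      rw [map_mul, map_pow, hvxt, one_pow, mul_one]
      exact hti i hi.1 (by omega)
    rw [Valuation.map_add_eq_of_lt_left _ htail, map_mul, hvxt, mul_one]
  have hva0 : V.valuation (a 0) = 1 := by
    have hid : f.eval c - y = -(f.eval x - f.eval c) + (f.eval x - y) := by ring
    have hv1 : V.valuation (f.eval x - y) < V.valuation (-(f.eval x - f.eval c)) := by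
      rw [Valuation.map_neg, hvfxc, he, hti']; exact hfy
    rw [ha0, map_div₀, hid, Valuation.map_add_eq_of_lt_left _ hv1, Valuation.map_neg, hvfxc,
      div_self hve0]
  have ha00 : a 0 ≠ 0 := fun h0 => by rw [h0, map_zero] at hva0; exact zero_ne_one hva0
  have haV : ∀ i, i ≤ N → a i ∈ V := by
    intro i hi
    rcases Nat.lt_or_ge i 2 with hlt | hge
    · interval_cases i
      · exact (V.valuation_le_one_iff _).mp hva0.le
      · rw [ha1]; exact V.one_mem
    · exact (V.valuation_le_one_iff _).mp (hasmall i hge hi).le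
  /- Step 6: the reversed polynomial `G`, monic over `O_L`, and its approximate root `w₀`. -/
  obtain ⟨w₀, hw₀⟩ : ∃ w₀ : Ω, w₀ = -(a 0)⁻¹ := ⟨_, rfl⟩
  have hvw₀ : V.valuation w₀ = 1 := by rw [hw₀, Valuation.map_neg, map_inv₀, hva0, inv_one]
  have hw₀V : w₀ ∈ V := (V.valuation_le_one_iff _).mp hvw₀.le
  have hw₀L : w₀ ∈ L := by rw [hw₀]; exact neg_mem (inv_mem (haL 0))
  -- coefficients `q i = a i / a 0`
  obtain ⟨q, hq⟩ : ∃ q : ℕ → Ω, q = fun i => a i / a 0 := ⟨_, rfl⟩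
  have hqi : ∀ i, q i = a i / a 0 := fun i => by rw [hq]
  have hqV : ∀ i, i ≤ N → q i ∈ V := fun i hi => by
    rw [hqi, ← V.valuation_le_one_iff, map_div₀, hva0, div_one]
    exact (V.valuation_le_one_iff _).mpr (haV i hi)
  have hqL : ∀ i, q i ∈ L := fun i => by rw [hqi]; exact div_mem (haL i) (haL 0)
  have hq1 : q 1 = -w₀ := by rw [hqi, ha1, hw₀, one_div, neg_neg]
  have hqsmall : ∀ i, 2 ≤ i → i ≤ N → V.valuation (q i) < 1 := fun i hi hiN => by
    rw [hqi, map_div₀, hva0, div_one]; exact hasmall i hi hiN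
  have haq : ∀ i, a 0 * q i = a i := fun i => by rw [hqi, mul_div_cancel₀ _ ha00]
  -- the tail `M` of `G` beyond its first two coefficients, and `G` itself
  set M : Polynomial Ω := ∑ i ∈ Ico 2 (N + 1), C (q i) * X ^ (N - i) with hM
  set G : Polynomial Ω := X ^ N + (C (q 1) * X ^ (N - 1) + M) with hG
  have hGsum : G = X ^ N + ∑ i ∈ Ico 1 (N + 1), C (q i) * X ^ (N - i) := by
    rw [hG, hM, sum_eq_sum_Ico_succ_bot (by omega : 1 < N + 1)]
  have hRsum : ∑ i ∈ Ico 1 (N + 1), C (q i) * X ^ (N - i) = C (q 1) * X ^ (N - 1) + M := by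
    rw [hM, sum_eq_sum_Ico_succ_bot (by omega : 1 < N + 1)]
  have hRdeg : (C (q 1) * X ^ (N - 1) + M).degree < (N : WithBot ℕ) := by
    rw [← hRsum]
    refine lt_of_le_of_lt (degree_sum_le _ _)
      ((Finset.sup_lt_iff (WithBot.bot_lt_coe N)).mpr fun i hi => ?_)
    rw [mem_Ico] at hi
    refine lt_of_le_of_lt (degree_C_mul_X_pow_le _ _) ?_
    exact WithBot.coe_lt_coe.mpr (Nat.sub_lt hN (by omega))
  have hGmon : G.Monic := by rw [hG]; exact monic_X_pow_add hRdeg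
  have hGcoeff : ∀ k, G.coeff k ∈ V ∧ G.coeff k ∈ L := by
    intro k
    rw [hGsum, coeff_add, coeff_X_pow, finsetSum_coeff]
    simp only [coeff_C_mul_X_pow]
    refine ⟨add_mem ?_ (sum_mem fun i hi => ?_), add_mem ?_ (sum_mem fun i hi => ?_)⟩
    · split_ifs <;> simp [V.one_mem, V.zero_mem]
    · rw [mem_Ico] at hi
      split_ifs
      · exact hqV i (by omega)
      · exact V.zero_mem
    · split_ifs <;> simp [L.one_mem, L.zero_mem]
    · split_ifs
      · exact hqL i
      · exact L.zero_mem
  -- `M` and `M'` are small at points of `V`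
  have hMcoeff : ∀ k, V.valuation (M.coeff k) < 1 := by
    intro k
    rw [hM, finsetSum_coeff]
    refine Valuation.map_sum_lt _ one_ne_zero fun i hi => ?_
    rw [mem_Ico] at hi
    rw [coeff_C_mul_X_pow]
    split_ifs
    · exact hqsmall i hi.1 (by omega)
    · rw [map_zero]; exact zero_lt_one
  have hM'coeff : ∀ k, V.valuation ((derivative M).coeff k) < 1 := by
    intro k
    rw [coeff_derivative, map_mul]
    have hnat : V.valuation ((k : Ω) + 1) ≤ 1 := by
      rw [← Nat.cast_succ]
      exact (V.valuation_le_one_iff _).mpr (natCast_mem V (k + 1))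
    calc V.valuation (M.coeff (k + 1)) * V.valuation ((k : Ω) + 1)
        ≤ V.valuation (M.coeff (k + 1)) * 1 := mul_le_mul' le_rfl hnat
      _ < 1 := by rw [mul_one]; exact hMcoeff (k + 1)
  obtain ⟨m, hm⟩ : ∃ m : ℕ, N = m + 1 := Nat.exists_eq_succ_of_ne_zero hN.ne'
  have hGw₀ : V.valuation (G.eval w₀) < 1 := by
    have hev : G.eval w₀ = (w₀ ^ N + q 1 * w₀ ^ (N - 1)) + M.eval w₀ := by
      rw [hG]; simp only [eval_add, eval_mul, eval_C, eval_pow, eval_X]; ring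
    have hfirst : w₀ ^ N + q 1 * w₀ ^ (N - 1) = 0 := by
      rw [hq1, hm, Nat.add_sub_cancel, pow_succ]; ring
    rw [hev, hfirst, zero_add]
    exact valuation_eval_lt_one_of_coeff V hMcoeff hw₀V
  have hG'w₀ : V.valuation ((derivative G).eval w₀) = 1 := by
    have hev : (derivative G).eval w₀ =
        ((N : Ω) * w₀ ^ (N - 1) + q 1 * ((N - 1 : ℕ) : Ω) * w₀ ^ (N - 1 - 1)) +
          (derivative M).eval w₀ := by
      rw [hG, derivative_add, derivative_add, derivative_X_pow, derivative_C_mul_X_pow]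
      simp only [eval_add, eval_mul, eval_C, eval_pow, eval_X]
      ring
    have hfirst : (N : Ω) * w₀ ^ (N - 1) + q 1 * ((N - 1 : ℕ) : Ω) * w₀ ^ (N - 1 - 1) =
        w₀ ^ (N - 1) := by
      rw [hq1, hm, Nat.add_sub_cancel]
      rcases m with _ | k
      · simp
      · rw [Nat.add_sub_cancel]
        push_cast
        ring
    rw [hev, hfirst]
    have hsmall : V.valuation ((derivative M).eval w₀) < V.valuation (w₀ ^ (N - 1)) := by
      rw [map_pow, hvw₀, one_pow]
      exact valuation_eval_lt_one_of_coeff V hM'coeff hw₀V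
    rw [Valuation.map_add_eq_of_lt_left _ hsmall, map_pow, hvw₀, one_pow]
  /- Step 7: Hensel's Lemma in the henselian `L`: a root `w` of `G` near `w₀`; `ζ = w⁻¹` is a
  root of `F°`. -/
  obtain ⟨w, hwL, hwV, hGw, hww₀⟩ :=
    exists_root_of_isHenselianField V hL hGmon hGcoeff hw₀L hw₀V hGw₀ hG'w₀
  have hvw : V.valuation w = 1 := by
    rw [← hvw₀] at hww₀
    rw [Valuation.map_eq_of_sub_lt _ hww₀, hvw₀]
  have hw0 : w ≠ 0 := fun h0 => by rw [h0, map_zero] at hvw; exact zero_ne_one hvw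
  obtain ⟨ζ, hζ⟩ : ∃ ζ : Ω, ζ = w⁻¹ := ⟨_, rfl⟩
  have hζL : ζ ∈ L := by rw [hζ]; exact inv_mem hwL
  have hvζ : V.valuation ζ = 1 := by rw [hζ, map_inv₀, hvw, inv_one]
  have hζV : ζ ∈ V := (V.valuation_le_one_iff _).mp hvζ.le
  have hwζ : w * ζ = 1 := by rw [hζ, mul_inv_cancel₀ hw0]
  have hsumζ : ∑ i ∈ range (N + 1), a i * ζ ^ i = 0 := by
    have hGw' : w ^ N + ∑ i ∈ Ico 1 (N + 1), q i * w ^ (N - i) = 0 := by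
      rw [hGsum] at hGw
      simpa only [eval_add, eval_pow, eval_X, eval_finsetSum, eval_mul, eval_C] using hGw
    have key : ∑ i ∈ range (N + 1), a i * ζ ^ i =
        a 0 * ζ ^ N * (w ^ N + ∑ i ∈ Ico 1 (N + 1), q i * w ^ (N - i)) := by
      rw [hsplit, pow_zero, mul_one, mul_add, mul_sum]
      congr 1
      · rw [mul_assoc, ← mul_pow, mul_comm ζ w, hwζ, one_pow, mul_one]
      · refine sum_congr rfl fun i hi => ?_
        rw [mem_Ico] at hi
        have hpow : ζ ^ N * w ^ (N - i) = ζ ^ i := by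
          rw [← pow_sub_mul_pow ζ (show i ≤ N by omega), mul_assoc, mul_comm (ζ ^ i),
            ← mul_assoc (ζ ^ (N - i)), ← mul_pow, mul_comm ζ w, hwζ, one_pow, one_mul]
        calc a i * ζ ^ i = (a 0 * q i) * (ζ ^ N * w ^ (N - i)) := by rw [haq, hpow]
          _ = a 0 * ζ ^ N * (q i * w ^ (N - i)) := by ring
    rw [key, hGw', mul_zero]
  /- Step 8: `v(x̃ - ζ) = v(F°(x̃))`. -/
  -- `∑ a i (x̃^i - ζ^i) = (x̃ - ζ) · ∑ a i gᵢ` with `g₁ = 1`, `g₀ = 0`, `gᵢ ∈ V`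
  obtain ⟨gs, hgs⟩ : ∃ gs : ℕ → Ω, gs = fun i => ∑ j ∈ range i, xt ^ j * ζ ^ (i - 1 - j) :=
    ⟨_, rfl⟩
  have hgsi : ∀ i, gs i * (xt - ζ) = xt ^ i - ζ ^ i := fun i => by rw [hgs]; exact geom_sum₂_mul xt ζ i
  have hgsV : ∀ i, gs i ∈ V := fun i => by
    rw [hgs]
    exact sum_mem fun j _ => mul_mem (pow_mem hxtV j) (pow_mem hζV _)
  have hgs0 : gs 0 = 0 := by rw [hgs]; simp
  have hgs1 : gs 1 = 1 := by rw [hgs]; simp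
  have hdiff : ∑ i ∈ range (N + 1), a i * xt ^ i - ∑ i ∈ range (N + 1), a i * ζ ^ i =
      (xt - ζ) * ∑ i ∈ range (N + 1), a i * gs i := by
    rw [← sum_sub_distrib, mul_sum]
    refine sum_congr rfl fun i _ => ?_
    rw [← mul_sub, ← hgsi]
    ring
  have hvS : V.valuation (∑ i ∈ range (N + 1), a i * gs i) = 1 := by
    rw [hsplit, sum_eq_sum_Ico_succ_bot (by omega : 1 < N + 1), hgs0, hgs1, ha1, mul_zero,
      zero_add, mul_one]
    have hsmall : V.valuation (∑ i ∈ Ico 2 (N + 1), a i * gs i) < V.valuation (1 : Ω) := by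
      rw [map_one]
      refine Valuation.map_sum_lt _ one_ne_zero fun i hi => ?_
      rw [mem_Ico] at hi
      rw [map_mul]
      calc V.valuation (a i) * V.valuation (gs i) ≤ V.valuation (a i) * 1 :=
            mul_le_mul' le_rfl ((V.valuation_le_one_iff _).mpr (hgsV i))
        _ < 1 := by rw [mul_one]; exact hasmall i hi.1 (by omega)
    rw [Valuation.map_add_eq_of_lt_left _ hsmall, map_one]
  have hvxtζ : V.valuation (xt - ζ) * V.valuation e = V.valuation (f.eval x - y) := by
    have h1 := congrArg V.valuation hdiff
    rw [hsumζ, sub_zero, hsumx, map_mul, hvS, mul_one, map_div₀] at h1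
    rw [← h1, div_mul_cancel₀ _ hve0]
  /- Step 9: the approximant `ℓ = c + bζ`. -/
  refine ⟨c + b * ζ, add_mem (hKL hcK) (mul_mem (hKL hbK) hζL), ?_⟩
  have : x - (c + b * ζ) = b * (xt - ζ) := by rw [mul_sub, ← hxc]; ring
  rw [this, map_mul, mul_assoc, ← hti' 1, ← he, hvxtζ]


end Literature.AlgebraicGeometry.Resolution
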